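import Mathlib
import Summits.CriticalPhenomena.Ising3DConformalLimit.Theorems.MarkovRigidityFieldRealisationLatticeField
import Summits.CriticalPhenomena.Ising3DConformalLimit.Theorems.MarkovRigidityFieldRealisationCriticalMeasure
import HarnessLib

/-!
# Route MarkovRigidity, support item `FieldRealisation` (stmt-CriticalPhenomena-11245):
# the FKG covariance bound for the smeared critical field (Newman's inequality)

Helper towards clause (b) of `FieldRealisation` (OS4 clustering of the continuum law is the limit of
this).  For the smeared laws `P = spinFieldLaw ν Λ δ r` under a measure `ν` carrying the critical
plus correlations and two test functions `f, h` with weights `a_x = r δ³ f(δx)`, `b_x = r δ³ h(δx)`: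
`‖S_P(f + h) − S_P(f) S_P(h)‖ ≤ 4 Σ_{x,y∈Λ} |a_x| |b_y| ⟨σ_xσ_y⟩_{β_c}`
(`norm_genFunctional_add_sub_mul_le`).  Proof (Newman 1980 via the FKG inequality of `ν`,
`integral_mul_integral_le_integral_mul_of_monotone`): for a trigonometric observable
`F = cos(Σ a_x σ_x)` or `sin(Σ a_x σ_x)` the observables `Σ|a_x|σ_x ± F` are nondecreasing
(`cos`, `sin` are `1`-Lipschitz), so four applications of FKG give
`|Cov(F, G)| ≤ Cov(Σ|a_x|σ_x, Σ|b_y|σ_y) = Σ |a_x||b_y| ⟨σ_xσ_y⟩` (the spins are centred at `β_c`),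
and `e^{iA} = cos A + i sin A`.

References: Newman, Comm. Math. Phys. 74 (1980) 119 (covariance inequality for associated variables);
Fortuin–Kasteleyn–Ginibre 1971; Glimm–Jaffe 1987 §6.1 (OS4).  No definitions are introduced.
-/

noncomputable section

namespace Summit.CriticalPhenomena.Ising3DConformalLimit.MarkovRigidityFieldRealisation

open MeasureTheory Filter Complex Literature.Probability.LatticeModels
  Literature.MathematicalPhysics.QuantumLattice
open Summit.CriticalPhenomena.Ising3DConformalLimit
open scoped Topology

variable {ν : Measure (SpinConfig (Site 3))} [IsProbabilityMeasure ν]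

/-! ### Lipschitz trigonometric observables are dominated by the absolute weights -/

/-- **Monotone majorants**: if `T` is `1`-Lipschitz then `s ↦ Σ_x |a_x| s_x ± T(Σ_x a_x s_x)` is
nondecreasing in the spins. [cite: FriedliVelenik2017, Thm. 3.21] -/
theorem monotone_absSum_add_lipschitz (Λ : Finset (Site 3)) (a : Site 3 → ℝ) {T : ℝ → ℝ}
    (hT : ∀ p q, |T p - T q| ≤ |p - q|) (ε : ℝ) (hε : ε = 1 ∨ ε = -1) :
    Monotone fun σ : SpinConfig (Site 3) =>
      ∑ x ∈ Λ, |a x| * spinAt x σ + ε * T (∑ x ∈ Λ, a x * spinAt x σ) := by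
  intro σ τ hστ
  have hxy : ∀ x, spinAt x σ ≤ spinAt x τ := fun x => by
    simp only [spinAt]; exact_mod_cast hστ x
  have hdiff : |T (∑ x ∈ Λ, a x * spinAt x τ) - T (∑ x ∈ Λ, a x * spinAt x σ)| ≤
      ∑ x ∈ Λ, |a x| * (spinAt x τ - spinAt x σ) := by
    refine (hT _ _).trans ?_
    rw [← Finset.sum_sub_distrib]
    refine (Finset.abs_sum_le_sum_abs _ _).trans (le_of_eq (Finset.sum_congr rfl fun x _ => ?_))
    rw [← mul_sub, abs_mul, abs_of_nonneg (sub_nonneg.2 (hxy x))]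
  have hε1 : |ε| = 1 := by rcases hε with rfl | rfl <;> simp
  dsimp only
  have key : ε * T (∑ x ∈ Λ, a x * spinAt x σ) - ε * T (∑ x ∈ Λ, a x * spinAt x τ) ≤
      ∑ x ∈ Λ, |a x| * (spinAt x τ - spinAt x σ) := by
    rw [← mul_sub]
    refine (le_abs_self _).trans ?_
    rw [abs_mul, hε1, one_mul, abs_sub_comm]
    exact hdiff
  have hsum : ∑ x ∈ Λ, |a x| * (spinAt x τ - spinAt x σ) =
      ∑ x ∈ Λ, |a x| * spinAt x τ - ∑ x ∈ Λ, |a x| * spinAt x σ := by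
    rw [← Finset.sum_sub_distrib]; refine Finset.sum_congr rfl fun x _ => ?_; ring
  linarith

/-! ### The FKG covariance bound -/

/-- **Newman's covariance bound from FKG** (real form): for `1`-Lipschitz `T, U` and weights `a, b`
on a finite `Λ`, `|Cov_ν(T(Σ a_xσ_x), U(Σ b_yσ_y))| ≤ E_ν[(Σ|a_x|σ_x)(Σ|b_y|σ_y)]` for the critical
measure (the four monotone combinations and FKG; the spins are centred).
[cite: FriedliVelenik2017, Thm. 3.21] -/
theorem abs_cov_lipschitz_le (hν : ∀ A : Finset (Site 3), spinCorr ν A = plusCorr 3 (criticalBeta 3) 0 A)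
    (Λ : Finset (Site 3)) (a b : Site 3 → ℝ) {T U : ℝ → ℝ} (hTc : Continuous T) (hUc : Continuous U)
    (hT : ∀ p q, |T p - T q| ≤ |p - q|) (hU : ∀ p q, |U p - U q| ≤ |p - q|)
    (hTb : ∃ C, ∀ p, |T p| ≤ C) (hUb : ∃ C, ∀ p, |U p| ≤ C) :
    |∫ σ, T (∑ x ∈ Λ, a x * spinAt x σ) * U (∑ y ∈ Λ, b y * spinAt y σ) ∂ν -
      (∫ σ, T (∑ x ∈ Λ, a x * spinAt x σ) ∂ν) * ∫ σ, U (∑ y ∈ Λ, b y * spinAt y σ) ∂ν| ≤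
      ∑ x ∈ Λ, ∑ y ∈ Λ, |a x| * |b y| * criticalCorr 3 2 ![x, y] := by
  classical
  obtain ⟨CT, hCT⟩ := hTb
  obtain ⟨CU, hCU⟩ := hUb
  -- the observables as functions of the spin field
  set A : (Site 3 → ℝ) → ℝ := fun s => ∑ x ∈ Λ, a x * s x with hA
  set Bf : (Site 3 → ℝ) → ℝ := fun s => ∑ y ∈ Λ, b y * s y with hBf
  set DA : (Site 3 → ℝ) → ℝ := fun s => ∑ x ∈ Λ, |a x| * s x with hDA
  set DB : (Site 3 → ℝ) → ℝ := fun s => ∑ y ∈ Λ, |b y| * s y with hDB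
  have hloc : ∀ (w : Site 3 → ℝ) (s t : Site 3 → ℝ), (∀ x ∈ Λ, s x = t x) →
      ∑ x ∈ Λ, w x * s x = ∑ x ∈ Λ, w x * t x := fun w s t hst =>
    Finset.sum_congr rfl fun x hx => by rw [hst x hx]
  -- FKG for the four monotone combinations
  have hFKG : ∀ (ε η : ℝ), (ε = 1 ∨ ε = -1) → (η = 1 ∨ η = -1) →
      (∫ σ, (DA (fun x => spinAt x σ) + ε * T (A (fun x => spinAt x σ))) ∂ν) *
        (∫ σ, (DB (fun x => spinAt x σ) + η * U (Bf (fun x => spinAt x σ))) ∂ν) ≤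
      ∫ σ, (DA (fun x => spinAt x σ) + ε * T (A (fun x => spinAt x σ))) *
        (DB (fun x => spinAt x σ) + η * U (Bf (fun x => spinAt x σ))) ∂ν := by
    intro ε η hε hη
    refine integral_mul_integral_le_integral_mul_of_monotone hν Λ
      (fun s => DA s + ε * T (A s)) (fun s => DB s + η * U (Bf s)) (fun s t hst => ?_)
      (fun s t hst => ?_) (monotone_absSum_add_lipschitz Λ a hT ε hε)
      (monotone_absSum_add_lipschitz Λ b hU η hη) ?_ ?_
    · simp only [hDA, hA, hloc _ s t hst]
    · simp only [hDB, hBf, hloc _ s t hst]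
    · exact (Finset.measurable_sum _ fun x _ => (measurable_spinAt x).const_mul _).add
        ((hTc.measurable.comp (Finset.measurable_sum _ fun x _ => (measurable_spinAt x).const_mul _)).const_mul _)
    · exact (Finset.measurable_sum _ fun x _ => (measurable_spinAt x).const_mul _).add
        ((hUc.measurable.comp (Finset.measurable_sum _ fun x _ => (measurable_spinAt x).const_mul _)).const_mul _)
  -- integrability of all the pieces (bounded measurable on a probability space)
  have hmA : Measurable fun σ : SpinConfig (Site 3) => A (fun x => spinAt x σ) :=
    Finset.measurable_sum _ fun x _ => (measurable_spinAt x).const_mul _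
  have hmB : Measurable fun σ : SpinConfig (Site 3) => Bf (fun x => spinAt x σ) :=
    Finset.measurable_sum _ fun x _ => (measurable_spinAt x).const_mul _
  have hmDA : Measurable fun σ : SpinConfig (Site 3) => DA (fun x => spinAt x σ) :=
    Finset.measurable_sum _ fun x _ => (measurable_spinAt x).const_mul _
  have hmDB : Measurable fun σ : SpinConfig (Site 3) => DB (fun x => spinAt x σ) :=
    Finset.measurable_sum _ fun x _ => (measurable_spinAt x).const_mul _
  have hbDA : ∀ σ : SpinConfig (Site 3), |DA (fun x => spinAt x σ)| ≤ ∑ x ∈ Λ, |a x| := fun σ => by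
    refine (Finset.abs_sum_le_sum_abs _ _).trans (le_of_eq (Finset.sum_congr rfl fun x _ => ?_))
    rw [abs_mul, abs_abs, abs_spinAt, mul_one]
  have hbDB : ∀ σ : SpinConfig (Site 3), |DB (fun x => spinAt x σ)| ≤ ∑ x ∈ Λ, |b x| := fun σ => by
    refine (Finset.abs_sum_le_sum_abs _ _).trans (le_of_eq (Finset.sum_congr rfl fun x _ => ?_))
    rw [abs_mul, abs_abs, abs_spinAt, mul_one]
  have hint : ∀ (g : SpinConfig (Site 3) → ℝ), Measurable g → ∀ C, (∀ σ, |g σ| ≤ C) → Integrable g ν :=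
    fun g hg C hC => Integrable.of_bound hg.aestronglyMeasurable C
      (Eventually.of_forall fun σ => by rw [Real.norm_eq_abs]; exact hC σ)
  set tT : SpinConfig (Site 3) → ℝ := fun σ => T (A (fun x => spinAt x σ)) with htT
  set tU : SpinConfig (Site 3) → ℝ := fun σ => U (Bf (fun x => spinAt x σ)) with htU
  set dA : SpinConfig (Site 3) → ℝ := fun σ => DA (fun x => spinAt x σ) with hdA
  set dB : SpinConfig (Site 3) → ℝ := fun σ => DB (fun x => spinAt x σ) with hdB
  have hiT : Integrable tT ν := hint _ (hTc.measurable.comp hmA) CT fun σ => hCT _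
  have hiU : Integrable tU ν := hint _ (hUc.measurable.comp hmB) CU fun σ => hCU _
  have hiDA : Integrable dA ν := hint _ hmDA _ hbDA
  have hiDB : Integrable dB ν := hint _ hmDB _ hbDB
  have hiDD : Integrable (fun σ => dA σ * dB σ) ν := hint _ (hmDA.mul hmDB) _ fun σ => by
    rw [abs_mul]; exact mul_le_mul (hbDA σ) (hbDB σ) (abs_nonneg _) (Finset.sum_nonneg fun _ _ => abs_nonneg _)
  have hiDU : Integrable (fun σ => dA σ * tU σ) ν := hint _ (hmDA.mul (hUc.measurable.comp hmB)) _
    fun σ => by rw [abs_mul]; exact mul_le_mul (hbDA σ) (hCU _) (abs_nonneg _) (Finset.sum_nonneg fun _ _ => abs_nonneg _)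
  have hiTD : Integrable (fun σ => tT σ * dB σ) ν := hint _ ((hTc.measurable.comp hmA).mul hmDB) _
    fun σ => by rw [abs_mul, mul_comm]; exact mul_le_mul (hbDB σ) (hCT _) (abs_nonneg _) (Finset.sum_nonneg fun _ _ => abs_nonneg _)
  have hiTU : Integrable (fun σ => tT σ * tU σ) ν := hint _ ((hTc.measurable.comp hmA).mul
    (hUc.measurable.comp hmB)) (|CT| * CU) fun σ => by
      rw [abs_mul]; exact mul_le_mul ((hCT _).trans (le_abs_self _)) (hCU _) (abs_nonneg _) (abs_nonneg _)
  -- the spins are centred: `E[dA] = 0`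
  have hcentred : ∫ σ, dA σ ∂ν = 0 := by
    simp only [hdA, hDA]
    rw [integral_finsetSum _ fun x _ => (hint _ (measurable_spinAt x) 1 fun σ => by
      rw [abs_spinAt]).const_mul _]
    refine Finset.sum_eq_zero fun x _ => ?_
    rw [integral_const_mul]
    have h1 : ∫ σ, spinAt x σ ∂ν = criticalCorr 3 1 ![x] := by
      rw [criticalCorr_eq_integral_spinMonomial hν]
      simp [spinMonomial]
    rw [h1, criticalCorr_eq_zero_of_odd le_rfl odd_one, mul_zero]
  have hcentredB : ∫ σ, dB σ ∂ν = 0 := by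
    simp only [hdB, hDB]
    rw [integral_finsetSum _ fun x _ => (hint _ (measurable_spinAt x) 1 fun σ => by
      rw [abs_spinAt]).const_mul _]
    refine Finset.sum_eq_zero fun x _ => ?_
    rw [integral_const_mul]
    have h1 : ∫ σ, spinAt x σ ∂ν = criticalCorr 3 1 ![x] := by
      rw [criticalCorr_eq_integral_spinMonomial hν]
      simp [spinMonomial]
    rw [h1, criticalCorr_eq_zero_of_odd le_rfl odd_one, mul_zero]
  -- `E[dA dB] = Σ |a||b| ⟨σσ⟩`
  have hDD : ∫ σ, dA σ * dB σ ∂ν = ∑ x ∈ Λ, ∑ y ∈ Λ, |a x| * |b y| * criticalCorr 3 2 ![x, y] := by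
    have hI : ∀ x y, Integrable (fun σ => |a x| * spinAt x σ * (|b y| * spinAt y σ)) ν := fun x y =>
      hint _ (((measurable_spinAt x).const_mul _).mul ((measurable_spinAt y).const_mul _))
        (|a x| * |b y|) fun σ => le_of_eq (by
          rw [abs_mul, abs_mul, abs_mul, abs_abs, abs_abs, abs_spinAt, abs_spinAt, mul_one, mul_one])
    simp only [hdA, hdB, hDA, hDB]
    simp_rw [Finset.sum_mul_sum]
    rw [integral_finsetSum _ fun x _ => integrable_finsetSum _ fun y _ => hI x y]
    refine Finset.sum_congr rfl fun x _ => ?_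
    rw [integral_finsetSum _ fun y _ => hI x y]
    refine Finset.sum_congr rfl fun y _ => ?_
    have : (fun σ : SpinConfig (Site 3) => |a x| * spinAt x σ * (|b y| * spinAt y σ)) =
        fun σ => (|a x| * |b y|) * spinMonomial ![x, y] σ := by
      funext σ; simp [spinMonomial, Fin.prod_univ_two]; ring
    rw [this, integral_const_mul, ← criticalCorr_eq_integral_spinMonomial hν]
  -- expand the four FKG inequalities
  have hexp : ∀ (ε η : ℝ), (ε = 1 ∨ ε = -1) → (η = 1 ∨ η = -1) →
      ε * (∫ σ, tT σ ∂ν) * (η * ∫ σ, tU σ ∂ν) ≤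
        (∫ σ, dA σ * dB σ ∂ν) + η * (∫ σ, dA σ * tU σ ∂ν) + ε * (∫ σ, tT σ * dB σ ∂ν) +
          ε * η * ∫ σ, tT σ * tU σ ∂ν := by
    intro ε η hε hη
    have h := hFKG ε η hε hη
    have hl : ∫ σ, (DA (fun x => spinAt x σ) + ε * T (A (fun x => spinAt x σ))) ∂ν =
        (∫ σ, dA σ ∂ν) + ε * ∫ σ, tT σ ∂ν := by
      rw [integral_add hiDA (hiT.const_mul ε), integral_const_mul]
    have hr : ∫ σ, (DB (fun x => spinAt x σ) + η * U (Bf (fun x => spinAt x σ))) ∂ν =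
        (∫ σ, dB σ ∂ν) + η * ∫ σ, tU σ ∂ν := by
      rw [integral_add hiDB (hiU.const_mul η), integral_const_mul]
    have hp : ∫ σ, (DA (fun x => spinAt x σ) + ε * T (A (fun x => spinAt x σ))) *
        (DB (fun x => spinAt x σ) + η * U (Bf (fun x => spinAt x σ))) ∂ν =
        (∫ σ, dA σ * dB σ ∂ν) + η * (∫ σ, dA σ * tU σ ∂ν) + ε * (∫ σ, tT σ * dB σ ∂ν) +
          ε * η * ∫ σ, tT σ * tU σ ∂ν := by
      have e : (fun σ => (DA (fun x => spinAt x σ) + ε * T (A (fun x => spinAt x σ))) *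
          (DB (fun x => spinAt x σ) + η * U (Bf (fun x => spinAt x σ)))) =
          fun σ => dA σ * dB σ + η * (dA σ * tU σ) + ε * (tT σ * dB σ) + ε * η * (tT σ * tU σ) := by
        funext σ; simp only [hdA, hdB, htT, htU]; ring
      rw [e, integral_add, integral_add, integral_add, integral_const_mul, integral_const_mul,
        integral_const_mul]
      · exact hiDD
      · exact hiDU.const_mul _
      · exact hiDD.add (hiDU.const_mul _)
      · exact hiTD.const_mul _
      · exact (hiDD.add (hiDU.const_mul _)).add (hiTD.const_mul _)
      · exact hiTU.const_mul _
    rw [hl, hr, hp, hcentred, hcentredB, zero_add, zero_add] at h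
    nlinarith [h]
  have h1 := hexp 1 1 (Or.inl rfl) (Or.inl rfl)
  have h2 := hexp (-1) (-1) (Or.inr rfl) (Or.inr rfl)
  have h3 := hexp 1 (-1) (Or.inl rfl) (Or.inr rfl)
  have h4 := hexp (-1) 1 (Or.inr rfl) (Or.inl rfl)
  rw [← hDD]
  change |(∫ σ, tT σ * tU σ ∂ν) - (∫ σ, tT σ ∂ν) * ∫ σ, tU σ ∂ν| ≤ ∫ σ, dA σ * dB σ ∂ν
  rw [abs_le]
  constructor <;> nlinarith [h1, h2, h3, h4]

/-- Real and imaginary parts of `e^{ia} e^{ib}` and `e^{ia}`. [folklore] -/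
theorem exp_I_mul_re_im (p : ℝ) :
    (cexp (I * (p : ℂ))).re = Real.cos p ∧ (cexp (I * (p : ℂ))).im = Real.sin p := by
  rw [mul_comm]
  exact ⟨Complex.exp_ofReal_mul_I_re p, Complex.exp_ofReal_mul_I_im p⟩

/-- **Newman's covariance bound for the smeared critical field** (lattice OS4 input): with the
weights `a_x = r δ³ f(δx)`, `b_y = r δ³ h(δy)`,
`‖S_P(f + h) − S_P(f) S_P(h)‖ ≤ 4 Σ_{x,y∈Λ} |a_x||b_y| ⟨σ_xσ_y⟩_{β_c}` for `P = spinFieldLaw ν Λ δ r`.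
[cite: GlimmJaffe1987, §6.1] -/
theorem norm_genFunctional_add_sub_mul_le
    (hν : ∀ A : Finset (Site 3), spinCorr ν A = plusCorr 3 (criticalBeta 3) 0 A)
    (Λ : Finset (Site 3)) (δ r : ℝ) (f h : SchwartzMap (EuclideanSpace ℝ (Fin 3)) ℝ) :
    ‖genFunctional (spinFieldLaw ν Λ δ r) (f + h) -
        genFunctional (spinFieldLaw ν Λ δ r) f * genFunctional (spinFieldLaw ν Λ δ r) h‖ ≤
      4 * ∑ x ∈ Λ, ∑ y ∈ Λ, |r * δ ^ 3 * f (δ • siteToE x)| * |r * δ ^ 3 * h (δ • siteToE y)| *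
        criticalCorr 3 2 ![x, y] := by
  set a : Site 3 → ℝ := fun x => r * δ ^ 3 * f (δ • siteToE x) with ha
  set b : Site 3 → ℝ := fun x => r * δ ^ 3 * h (δ • siteToE x) with hb
  set V : ℝ := ∑ x ∈ Λ, ∑ y ∈ Λ, |a x| * |b y| * criticalCorr 3 2 ![x, y] with hV
  set Xf : SpinConfig (Site 3) → ℝ := fun σ => ∑ x ∈ Λ, a x * spinAt x σ with hXf
  set Xh : SpinConfig (Site 3) → ℝ := fun σ => ∑ y ∈ Λ, b y * spinAt y σ with hXh
  have hXf' : ∀ σ, spinField Λ δ r σ f = Xf σ := fun σ => spinField_apply_eq_sum Λ δ r σ f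
  have hXh' : ∀ σ, spinField Λ δ r σ h = Xh σ := fun σ => spinField_apply_eq_sum Λ δ r σ h
  have hXfh : ∀ σ, spinField Λ δ r σ (f + h) = Xf σ + Xh σ := fun σ => by
    rw [map_add, hXf', hXh']
  -- the four real covariances
  have hcos1 : ∀ p : ℝ, |Real.cos p| ≤ 1 := Real.abs_cos_le_one
  have hsin1 : ∀ p : ℝ, |Real.sin p| ≤ 1 := Real.abs_sin_le_one
  have hCC := abs_cov_lipschitz_le hν Λ a b Real.continuous_cos Real.continuous_cos
    Real.abs_cos_sub_cos_le Real.abs_cos_sub_cos_le ⟨1, hcos1⟩ ⟨1, hcos1⟩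
  have hSS := abs_cov_lipschitz_le hν Λ a b Real.continuous_sin Real.continuous_sin
    Real.abs_sin_sub_sin_le Real.abs_sin_sub_sin_le ⟨1, hsin1⟩ ⟨1, hsin1⟩
  have hSC := abs_cov_lipschitz_le hν Λ a b Real.continuous_sin Real.continuous_cos
    Real.abs_sin_sub_sin_le Real.abs_cos_sub_cos_le ⟨1, hsin1⟩ ⟨1, hcos1⟩
  have hCS := abs_cov_lipschitz_le hν Λ a b Real.continuous_cos Real.continuous_sin
    Real.abs_cos_sub_cos_le Real.abs_sin_sub_sin_le ⟨1, hcos1⟩ ⟨1, hsin1⟩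
  -- the generating functionals as spin integrals
  have hmeasX : ∀ (w : Site 3 → ℝ), Measurable fun σ : SpinConfig (Site 3) => ∑ x ∈ Λ, w x * spinAt x σ :=
    fun w => Finset.measurable_sum _ fun x _ => (measurable_spinAt x).const_mul _
  have hint : ∀ (G : SpinConfig (Site 3) → ℂ), Measurable G → (∀ σ, ‖G σ‖ ≤ 1) → Integrable G ν :=
    fun G hG hb => Integrable.of_bound hG.aestronglyMeasurable 1 (Eventually.of_forall hb)
  have hintR : ∀ (G : SpinConfig (Site 3) → ℝ), Measurable G → (∀ σ, |G σ| ≤ 1) → Integrable G ν :=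
    fun G hG hb => Integrable.of_bound hG.aestronglyMeasurable 1
      (Eventually.of_forall fun σ => by rw [Real.norm_eq_abs]; exact hb σ)
  have hexpm : ∀ (w : Site 3 → ℝ), Measurable fun σ : SpinConfig (Site 3) =>
      cexp (I * ((∑ x ∈ Λ, w x * spinAt x σ : ℝ) : ℂ)) := fun w =>
    (Complex.continuous_exp.comp (continuous_const.mul Complex.continuous_ofReal)).measurable.comp
      (hmeasX w)
  have hGf : genFunctional (spinFieldLaw ν Λ δ r) f = ∫ σ, cexp (I * ((Xf σ : ℝ) : ℂ)) ∂ν := by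
    rw [genFunctional_spinFieldLaw]; simp_rw [hXf']
  have hGh : genFunctional (spinFieldLaw ν Λ δ r) h = ∫ σ, cexp (I * ((Xh σ : ℝ) : ℂ)) ∂ν := by
    rw [genFunctional_spinFieldLaw]; simp_rw [hXh']
  have hGfh : genFunctional (spinFieldLaw ν Λ δ r) (f + h) =
      ∫ σ, cexp (I * ((Xf σ : ℝ) : ℂ)) * cexp (I * ((Xh σ : ℝ) : ℂ)) ∂ν := by
    rw [genFunctional_spinFieldLaw]
    refine integral_congr_ae (Eventually.of_forall fun σ => ?_)
    dsimp only
    rw [hXfh]; push_cast; rw [mul_add, Complex.exp_add]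
  have hi1 : Integrable (fun σ => cexp (I * ((Xf σ : ℝ) : ℂ))) ν :=
    hint _ (hexpm a) fun σ => by rw [Complex.norm_exp_I_mul_ofReal]
  have hi2 : Integrable (fun σ => cexp (I * ((Xh σ : ℝ) : ℂ))) ν :=
    hint _ (hexpm b) fun σ => by rw [Complex.norm_exp_I_mul_ofReal]
  have hi12 : Integrable (fun σ => cexp (I * ((Xf σ : ℝ) : ℂ)) * cexp (I * ((Xh σ : ℝ) : ℂ))) ν :=
    hint _ ((hexpm a).mul (hexpm b)) fun σ => by
      rw [norm_mul, Complex.norm_exp_I_mul_ofReal, Complex.norm_exp_I_mul_ofReal, mul_one]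
  -- real and imaginary parts
  set z : ℂ := genFunctional (spinFieldLaw ν Λ δ r) (f + h) -
    genFunctional (spinFieldLaw ν Λ δ r) f * genFunctional (spinFieldLaw ν Λ δ r) h with hz
  have hR : ∀ {G : SpinConfig (Site 3) → ℂ}, Integrable G ν →
      (∫ σ, G σ ∂ν).re = ∫ σ, (G σ).re ∂ν ∧ (∫ σ, G σ ∂ν).im = ∫ σ, (G σ).im ∂ν := fun hG => by
    have h1 := integral_re hG
    have h2 := integral_im hG
    simp only [RCLike.re_to_complex, RCLike.im_to_complex] at h1 h2
    exact ⟨h1.symm, h2.symm⟩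
  have hre : z.re = (∫ σ, Real.cos (Xf σ) * Real.cos (Xh σ) ∂ν -
      (∫ σ, Real.cos (Xf σ) ∂ν) * ∫ σ, Real.cos (Xh σ) ∂ν) -
      (∫ σ, Real.sin (Xf σ) * Real.sin (Xh σ) ∂ν -
        (∫ σ, Real.sin (Xf σ) ∂ν) * ∫ σ, Real.sin (Xh σ) ∂ν) := by
    rw [hz, hGfh, hGf, hGh, Complex.sub_re, Complex.mul_re, (hR hi12).1, (hR hi1).1, (hR hi2).1,
      (hR hi1).2, (hR hi2).2]
    simp only [Complex.mul_re, (exp_I_mul_re_im _).1, (exp_I_mul_re_im _).2]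
    rw [integral_sub]
    · ring
    · exact hintR _ ((Real.continuous_cos.measurable.comp (hmeasX a)).mul
        (Real.continuous_cos.measurable.comp (hmeasX b))) fun σ => by
          rw [abs_mul]; exact mul_le_one₀ (hcos1 _) (abs_nonneg _) (hcos1 _)
    · exact hintR _ ((Real.continuous_sin.measurable.comp (hmeasX a)).mul
        (Real.continuous_sin.measurable.comp (hmeasX b))) fun σ => by
          rw [abs_mul]; exact mul_le_one₀ (hsin1 _) (abs_nonneg _) (hsin1 _)
  have him : z.im = (∫ σ, Real.sin (Xf σ) * Real.cos (Xh σ) ∂ν -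
      (∫ σ, Real.sin (Xf σ) ∂ν) * ∫ σ, Real.cos (Xh σ) ∂ν) +
      (∫ σ, Real.cos (Xf σ) * Real.sin (Xh σ) ∂ν -
        (∫ σ, Real.cos (Xf σ) ∂ν) * ∫ σ, Real.sin (Xh σ) ∂ν) := by
    rw [hz, hGfh, hGf, hGh, Complex.sub_im, Complex.mul_im, (hR hi12).2, (hR hi1).1, (hR hi2).1,
      (hR hi1).2, (hR hi2).2]
    simp only [Complex.mul_im, (exp_I_mul_re_im _).1, (exp_I_mul_re_im _).2]
    rw [integral_add]
    · ring
    · exact hintR _ ((Real.continuous_cos.measurable.comp (hmeasX a)).mul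
        (Real.continuous_sin.measurable.comp (hmeasX b))) fun σ => by
          rw [abs_mul]; exact mul_le_one₀ (hcos1 _) (abs_nonneg _) (hsin1 _)
    · exact hintR _ ((Real.continuous_sin.measurable.comp (hmeasX a)).mul
        (Real.continuous_cos.measurable.comp (hmeasX b))) fun σ => by
          rw [abs_mul]; exact mul_le_one₀ (hsin1 _) (abs_nonneg _) (hcos1 _)
  calc ‖z‖ ≤ |z.re| + |z.im| := Complex.norm_le_abs_re_add_abs_im z
    _ ≤ (V + V) + (V + V) := by
        rw [hre, him]
        refine add_le_add ((abs_sub _ _).trans (add_le_add hCC hSS)) ((abs_add_le _ _).trans (add_le_add hSC hCS))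
    _ = 4 * V := by ring

end Summit.CriticalPhenomena.Ising3DConformalLimit.MarkovRigidityFieldRealisation

end
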